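import Literature.NumberTheory.Sieve.HeathBrownMorozClassFLExplicit
import HarnessLib

/-!
# HBM Lemma 3.1 (the class Lemma 3.5), III: the bound from the explicit comparison

Pure-proof file in the residue-class ("coset") port of D. R. Heath-Brown, *Primes represented by
`x³ + 2y³`*, Acta Math. 186 (2001), §6 pp. 38–39, to the class `x ≡ a, y ≡ b (mod d)` of
Heath-Brown–Moroz, Proc. LMS 88 (2004), Lemma 3.1: the class analogue of
`lemma_3_5_bound_of_params` (`HeathBrownCubicFLAssembly`).  Given the growth conditions
`(E3)–(E8)` of the `d = 1` proof (with the class level constant `C_L` of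
`HeathBrownMorozClassLevel.class_level` in `(E8)`) and `z = X^τ > d`, the explicit class comparison
`class_sum_abs_Tpiece_sub_le_explicit` yields
`∑_n |T^(n)(𝒜_f) − classKappa·T^(n)(ℬ)| ≤ (ω(C_𝒜C_{P𝒜}e³ + σ₀e³C_FLγ₀K_V + 4) + 1)·τη²X²/log X`,
`ω = w(d)/d²`.  The four groups of terms are estimated word for word as in the `d = 1` file; the
class only multiplies three of them by `ω` (`classSizeA_mul_classProd`, `classKappa = ωκ`).
Content: **`class_lemma_3_5_bound_of_params`**.  What remains for `h35` is the verification of the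
growth conditions for `τ = (log log X)^{-ϖ}` (as in `HeathBrown2001_lemma_3_5_of`, plus `X^τ > d`).
[cite: HeathBrownMoroz2004, Lemma 3.1] [cite: HeathBrownActa2001, §6 pp. 38–39]
Search: `lean search 'lemma_3_5_bound_of_params'` — the `d = 1` version only.
-/

noncomputable section

open NumberField Finset Filter

open scoped Topology

namespace Literature.NumberTheory.Sieve.CubicSieve

open LFunctions.CubeRootTwoField CubicPrimes

set_option maxHeartbeats 1000000 in
open scoped Classical in
/-- **HBM Lemma 3.1 (the class Lemma 3.5) with level `D = X^{1/4}`, given the parameter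
inequalities** — the class analogue of `lemma_3_5_bound_of_params`: with `z = X^τ > d`, `L = log X`,
`0 < τ ≤ 1/4`, `e^{-L^{1/3}} ≤ η ≤ 1` and the growth conditions `(E3)–(E8)` of the `d = 1` case
(with the class level constant `C_L` in `(E8)`), the explicit class comparison
`class_sum_abs_Tpiece_sub_le_explicit` gives
`∑_n |T^(n)(𝒜_f) − classKappa·T^(n)(ℬ)| ≤ (ω(C_𝒜C_{P𝒜}e³ + σ₀e³C_FLγ₀K_V + 4) + 1)·τη²X²/log X`,
`ω = w(d)/d²`: the four groups of terms are those of pp. 38–39 of the 2001 paper, three of them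
multiplied by `ω`. [cite: HeathBrownMoroz2004, Lemma 3.1] [cite: HeathBrownActa2001, §6 pp. 38–39] -/
theorem class_lemma_3_5_bound_of_params {σ₀ : ℝ} (hσ₀ : 0 < σ₀)
    {C_A : ℝ} (hFLA : FLBound dimConst C_A) (hCA : 0 ≤ C_A)
    {K₀ C_FL C_W C_B : ℝ} (hFLB : FLBound K₀ C_FL) (hCFL : 0 ≤ C_FL) (hK : HasSieveDimension normDensity 3 K₀)
    (hW : WindowBound C_W) (hCW : 0 ≤ C_W) (hB : CountBBound C_B) (hCB : 0 ≤ C_B)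
    {C₇ z₇ : ℝ} (hC7 : 0 ≤ C₇)
    (h7 : ∀ z : ℝ, z₇ ≤ z → |6 / Real.pi ^ 2 * prodA z - σ₀ * mertensProd z| ≤ C₇ * mertensProd z / Real.log z)
    {C₉ z₉ : ℝ} (hC9 : 0 ≤ C₉)
    (h9 : ∀ z : ℝ, z₉ ≤ z → |gamma₀ * prodB z - mertensProd z| ≤ C₉ * mertensProd z / Real.log z)
    {C_PA z_PA : ℝ} (hCPA : 0 ≤ C_PA) (hPA : ∀ z : ℝ, z_PA ≤ z → prodA z ≤ C_PA / Real.log z)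
    {K_V : ℝ} (hKV : ∀ z : ℝ, 2 ≤ z → prodB z ≤ K_V / Real.log z)
    {C₁ : ℝ} (hW1 : ∀ X τ : ℝ, 1 < X → 0 < τ → τ ≤ 1 / 2 → (2 : ℝ) ^ 10 ≤ X ^ τ →
      2 * C₁ ≤ τ * Real.log X → smallPrimesWeight X τ ≤ Real.log (1 / τ) + 3)
    {d : ℕ} (hd : 0 < d) (a b : ℕ) {θ C_L : ℝ} {X η τ : ℝ}
    (hLEV : ∑ R ∈ (idealsLE ⌊X ^ (3 / 2 : ℝ)⌋₊).filter (fun R => Squarefree (Ideal.absNorm R)),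
        |(classCountA X η d a b R : ℝ) -
          (if Nat.Coprime d (Ideal.absNorm R) then
            classSizeA X η d * rho₂ R / Ideal.absNorm R else 0)| ≤ C_L * X ^ θ)
    (hX : 3 ≤ X) (hτ0 : 0 < τ) (hτ4 : τ ≤ 1 / 4) (hdz : (d : ℝ) < X ^ τ)
    (hηlo : Real.exp (-Real.log X ^ (1 / 3 : ℝ)) ≤ η) (hη1 : η ≤ 1)
    (hz16 : 16 ≤ X ^ τ) (hz7 : z₇ ≤ X ^ τ) (hz9 : z₉ ≤ X ^ τ) (hzPA : z_PA ≤ X ^ τ) (hz10 : (2 : ℝ) ^ 10 ≤ X ^ τ)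
    (hC1 : 2 * C₁ ≤ τ * Real.log X)
    (hE3 : Real.exp (-(1 / (4 * τ))) ≤ τ ^ 5)
    (hE4 : 14 * Real.exp 3 * (C₇ + σ₀ * C₉) ≤ τ ^ 4 * Real.log X)
    (hE5 : 1904 * σ₀ * Real.exp 3 ≤ τ ^ 4 * (X ^ τ) ^ (1 / 3 : ℝ))
    (hE6 : 3 * σ₀ * Real.exp 3 * C_B * Real.log X ≤ τ ^ 2 * Real.sqrt (X ^ τ) * Real.exp (-Real.log X ^ (1 / 3 : ℝ)))
    (hE7 : 2 * σ₀ * Real.exp 35 * C_W * Real.log X ^ 9 ≤ τ ^ 2 * Real.sqrt X * Real.exp (-Real.log X ^ (1 / 3 : ℝ)))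
    (hE8 : C_L * Real.log X * Real.exp (2 * Real.log X ^ (1 / 3 : ℝ)) * X ^ θ ≤ τ * X ^ 2) (N : ℕ) :
    ∑ n ∈ range N, |(Tpiece (classPairs X η d a b) pairIdeal X τ n : ℝ) -
        classKappa σ₀ X η d * Tpiece (normWindow X η) (fun J => J) X τ n| ≤
      (classWeight d / (d : ℝ) ^ 2 *
          (C_A * C_PA * Real.exp 3 + σ₀ * Real.exp 3 * C_FL * gamma₀ * K_V + 4) + 1) *
        τ * η ^ 2 * X ^ 2 / Real.log X := by
  -- notation and basic positivity
  set L := Real.log X with hL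
  set z := X ^ τ with hz
  set D := X ^ (1 / 4 : ℝ) with hD
  have hX1 : 1 < X := by linarith
  have hX0 : 0 < X := by linarith
  have hL1 : 1 ≤ L := by
    rw [hL, ← Real.log_exp 1]
    exact Real.log_le_log (Real.exp_pos 1) (by linarith [Real.exp_one_lt_d9])
  have hL0 : 0 < L := by linarith
  have hη0 : 0 < η := lt_of_lt_of_le (Real.exp_pos _) hηlo
  have hτ1 : τ ≤ 1 := by linarith
  have hlogz : Real.log z = τ * L := by rw [hz, Real.log_rpow hX0]
  have hlogD : Real.log D = L / 4 := by rw [hD, Real.log_rpow hX0]; ring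
  have hτL0 : 0 < τ * L := mul_pos hτ0 hL0
  have hz0 : 0 < z := by linarith
  have hzD : z ≤ D := by
    rw [hz, hD]; exact Real.rpow_le_rpow_of_exponent_le hX1.le hτ4
  have hD' : D * X ^ (1 + τ) ≤ X ^ (3 / 2 : ℝ) := by
    rw [hD, ← Real.rpow_add hX0]
    exact Real.rpow_le_rpow_of_exponent_le hX1.le (by linarith)
  have hs : Real.exp (-(Real.log D / Real.log z)) = Real.exp (-(1 / (4 * τ))) := by
    rw [hlogD, hlogz]; congr 2; field_simp
  -- `e^{W₁} ≤ e³/τ` and `W₁ ≤ 1/τ + 3`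
  set W := smallPrimesWeight X τ with hWdef
  have hWle : W ≤ Real.log (1 / τ) + 3 := hW1 X τ hX1 hτ0 (by linarith) hz10 hC1
  have hWle' : W ≤ 1 / τ + 3 := by
    have : Real.log (1 / τ) ≤ 1 / τ := (Real.log_le_sub_one_of_pos (by positivity)).trans (by linarith)
    linarith
  have heW : Real.exp W ≤ Real.exp 3 / τ := by
    calc Real.exp W ≤ Real.exp (Real.log (1 / τ) + 3) := Real.exp_le_exp.mpr hWle
      _ = Real.exp 3 / τ := by rw [Real.exp_add, Real.exp_log (by positivity)]; field_simp
  have heW0 : 0 < Real.exp W := Real.exp_pos W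
  -- the explicit comparison
  have hmaster := class_sum_abs_Tpiece_sub_le_explicit hσ₀ hFLA hCA hFLB hCFL hK hW hCW hB hCB h7 h9
    hd a b hX1.le hη0.le hη1 hz16 hz7 hz9 hdz hzD hD' N
  rw [hs] at hmaster
  -- the unit
  set U := τ * η ^ 2 * X ^ 2 / L with hU
  have hU0 : 0 < U := by positivity
  -- products
  have hV := mertensProd_le (show (2 : ℝ) ≤ z by linarith)
  obtain ⟨hV0, -⟩ := mertensProd_pos_le z
  have hPAle : prodA z ≤ C_PA / (τ * L) := by rw [← hlogz]; exact hPA z hzPA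
  have hPBle : prodB z ≤ K_V / (τ * L) := by rw [← hlogz]; exact hKV z (by linarith)
  obtain ⟨hPA0, -⟩ := prodA_pos_le z
  obtain ⟨hPB0, -⟩ := prodB_pos_le z
  have hKV0 : 0 ≤ K_V := by
    have := hPB0.le.trans hPBle
    rwa [le_div_iff₀ hτL0, zero_mul] at this
  rw [hlogz] at hV
  -- Group 1: the FL main error on the `𝒜`-side
  have hsizeA : sizeA X η ≤ η ^ 2 * X ^ 2 := by
    rw [sizeA, div_le_iff₀ (by positivity)]
    have hpi : (6 : ℝ) ≤ Real.pi ^ 2 := by nlinarith only [Real.pi_gt_three]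
    have h0 : 0 ≤ η ^ 2 * X ^ 2 := by positivity
    have := mul_le_mul_of_nonneg_left hpi h0
    linarith only [this]
  have hG1 : C_A * sizeA X η * prodA z * Real.exp (-(1 / (4 * τ))) * Real.exp W ≤ C_A * C_PA * Real.exp 3 * U := by
    calc C_A * sizeA X η * prodA z * Real.exp (-(1 / (4 * τ))) * Real.exp W
        ≤ C_A * (η ^ 2 * X ^ 2) * (C_PA / (τ * L)) * τ ^ 5 * (Real.exp 3 / τ) := by
          gcongr
    _ = C_A * C_PA * Real.exp 3 * U * τ ^ 2 := by rw [hU]; field_simp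
    _ ≤ C_A * C_PA * Real.exp 3 * U * 1 := by
          refine mul_le_mul_of_nonneg_left (pow_le_one₀ hτ0.le hτ1) (by positivity)
    _ = _ := mul_one _
  -- Group 2: the level of distribution
  have hG2 : ∑ R ∈ (idealsLE ⌊X ^ (3 / 2 : ℝ)⌋₊).filter (fun R => Squarefree (Ideal.absNorm R)),
      |(classCountA X η d a b R : ℝ) -
        (if Nat.Coprime d (Ideal.absNorm R) then
          classSizeA X η d * rho₂ R / Ideal.absNorm R else 0)| ≤ U := by
    refine hLEV.trans ?_
    -- `C_L X^θ ≤ τ e^{-2L^{1/3}} X²/L ≤ U`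
    have hexp : Real.exp (-L ^ (1 / 3 : ℝ)) ^ 2 ≤ η ^ 2 := pow_le_pow_left₀ (Real.exp_pos _).le hηlo 2
    have h1 : C_L * X ^ θ ≤ τ * X ^ 2 * Real.exp (-L ^ (1 / 3 : ℝ)) ^ 2 / L := by
      rw [le_div_iff₀ hL0, ← Real.exp_nat_mul, show ((2 : ℕ) : ℝ) * -L ^ (1 / 3 : ℝ) = -(2 * L ^ (1 / 3 : ℝ)) by
        push_cast; ring, Real.exp_neg]
      have hE := Real.exp_pos (2 * L ^ (1 / 3 : ℝ))
      rw [← div_eq_mul_inv, le_div_iff₀ hE]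
      calc C_L * X ^ θ * L * Real.exp (2 * L ^ (1 / 3 : ℝ)) = C_L * L * Real.exp (2 * L ^ (1 / 3 : ℝ)) * X ^ θ := by ring
        _ ≤ τ * X ^ 2 := hE8
    calc C_L * X ^ θ ≤ τ * X ^ 2 * Real.exp (-L ^ (1 / 3 : ℝ)) ^ 2 / L := h1
      _ ≤ τ * X ^ 2 * η ^ 2 / L := by gcongr
      _ = U := by rw [hU]; ring
  -- Group 3: the `ℬ`-side through `κ e^{W₁} ≤ σ₀ηe³/(3Xτ)`
  have hκ : kappa σ₀ X η * Real.exp W ≤ σ₀ * η * Real.exp 3 / (3 * X * τ) := by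
    rw [kappa]
    calc σ₀ * η / (3 * X) * Real.exp W ≤ σ₀ * η / (3 * X) * (Real.exp 3 / τ) :=
          mul_le_mul_of_nonneg_left heW (by positivity)
      _ = _ := by field_simp
  have hκ0 : 0 ≤ kappa σ₀ X η := by rw [kappa]; positivity
  -- (3a) discrepancy
  have hG3a : σ₀ * η * Real.exp 3 / (3 * X * τ) * (9 * C_B * X ^ 3 / Real.sqrt z) ≤ U := by
    have hsq0 : 0 < Real.sqrt z := Real.sqrt_pos.mpr hz0
    -- `= 3σ₀e³C_B ηX² τ⁻¹ z^{-1/2}` and `3σ₀e³C_B L ≤ τ²√z e^{-L^{1/3}} ≤ τ²√z η`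
    have hkey : 3 * σ₀ * Real.exp 3 * C_B * L ≤ τ ^ 2 * Real.sqrt z * η :=
      hE6.trans (mul_le_mul_of_nonneg_left hηlo (by positivity))
    have hXne : X ≠ 0 := hX0.ne'
    have hτne : τ ≠ 0 := hτ0.ne'
    have hLne : L ≠ 0 := hL0.ne'
    have hsqne : Real.sqrt z ≠ 0 := hsq0.ne'
    calc σ₀ * η * Real.exp 3 / (3 * X * τ) * (9 * C_B * X ^ 3 / Real.sqrt z)
        = (3 * σ₀ * Real.exp 3 * C_B * L) * (η * X ^ 2 / (L * τ * Real.sqrt z)) := by field_simp; ring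
      _ ≤ (τ ^ 2 * Real.sqrt z * η) * (η * X ^ 2 / (L * τ * Real.sqrt z)) :=
          mul_le_mul_of_nonneg_right hkey (by positivity)
      _ = U := by rw [hU]; field_simp
  -- (3b) FL main error on the `ℬ`-side
  have hG3b : σ₀ * η * Real.exp 3 / (3 * X * τ) *
      (C_FL * (3 * gamma₀ * η * X ^ 3) * prodB z * Real.exp (-(1 / (4 * τ)))) ≤ σ₀ * Real.exp 3 * C_FL * gamma₀ * K_V * U := by
    have hγ := gamma₀_pos
    calc σ₀ * η * Real.exp 3 / (3 * X * τ) * (C_FL * (3 * gamma₀ * η * X ^ 3) * prodB z * Real.exp (-(1 / (4 * τ))))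
        ≤ σ₀ * η * Real.exp 3 / (3 * X * τ) * (C_FL * (3 * gamma₀ * η * X ^ 3) * (K_V / (τ * L)) * τ ^ 5) := by
          gcongr
      _ = σ₀ * Real.exp 3 * C_FL * gamma₀ * K_V * U * τ ^ 2 := by rw [hU]; field_simp
      _ ≤ σ₀ * Real.exp 3 * C_FL * gamma₀ * K_V * U * 1 :=
          mul_le_mul_of_nonneg_left (pow_le_one₀ hτ0.le hτ1) (by positivity)
      _ = _ := mul_one _
  -- (3c) the `ℬ`-remainders
  have hG3c : σ₀ * η * Real.exp 3 / (3 * X * τ) * (C_W * (Real.exp 32 * Real.log z ^ 8) *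
      ((6 * X ^ 3) ^ (2 / 3 : ℝ) * X ^ ((1 + τ) / 3) * D ^ (1 / 3 : ℝ) + D * X ^ (1 + τ))) ≤ U := by
    -- the bracket is `≤ 5 X^{5/2}`
    have h6 : (6 * X ^ 3) ^ (2 / 3 : ℝ) ≤ 4 * X ^ 2 := by
      rw [Real.mul_rpow (by norm_num) (by positivity), show (X ^ 3 : ℝ) = X ^ (3 : ℝ) by norm_cast,
        ← Real.rpow_mul hX0.le, show (3 : ℝ) * (2 / 3) = 2 by norm_num, show X ^ (2 : ℝ) = X ^ 2 by norm_cast]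
      refine mul_le_mul_of_nonneg_right ?_ (by positivity)
      -- `6^{2/3} ≤ 4` since `6² ≤ 4³`
      have : (6 : ℝ) ^ (2 / 3 : ℝ) = ((6 : ℝ) ^ (2 : ℝ)) ^ (1 / 3 : ℝ) := by rw [← Real.rpow_mul (by norm_num)]; norm_num
      rw [this, show (4 : ℝ) = ((64 : ℝ)) ^ (1 / 3 : ℝ) by
        rw [show (64 : ℝ) = 4 ^ (3 : ℝ) by norm_num, ← Real.rpow_mul (by norm_num)]; norm_num]
      exact Real.rpow_le_rpow (by positivity) (by norm_num) (by norm_num)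
    have hX53 : X ^ ((1 + τ) / 3) ≤ X ^ (5 / 12 : ℝ) := Real.rpow_le_rpow_of_exponent_le hX1.le (by linarith)
    have hD13 : D ^ (1 / 3 : ℝ) = X ^ (1 / 12 : ℝ) := by rw [hD, ← Real.rpow_mul hX0.le]; norm_num
    have hDX : D * X ^ (1 + τ) ≤ X ^ (5 / 2 : ℝ) := by
      rw [hD, ← Real.rpow_add hX0]; exact Real.rpow_le_rpow_of_exponent_le hX1.le (by linarith)
    have hbr : (6 * X ^ 3) ^ (2 / 3 : ℝ) * X ^ ((1 + τ) / 3) * D ^ (1 / 3 : ℝ) + D * X ^ (1 + τ) ≤ 5 * X ^ (5 / 2 : ℝ) := by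
      have h1 : (6 * X ^ 3) ^ (2 / 3 : ℝ) * X ^ ((1 + τ) / 3) * D ^ (1 / 3 : ℝ) ≤ 4 * X ^ (5 / 2 : ℝ) := by
        rw [hD13]
        calc (6 * X ^ 3) ^ (2 / 3 : ℝ) * X ^ ((1 + τ) / 3) * X ^ (1 / 12 : ℝ)
            ≤ (4 * X ^ 2) * X ^ (5 / 12 : ℝ) * X ^ (1 / 12 : ℝ) := by gcongr
          _ = 4 * X ^ (5 / 2 : ℝ) := by
              rw [show (X ^ 2 : ℝ) = X ^ (2 : ℝ) by norm_cast, mul_assoc, mul_assoc, ← Real.rpow_add hX0,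
                ← Real.rpow_add hX0]
              norm_num
      linarith
    have hlogz8 : Real.log z ^ 8 ≤ L ^ 8 := by
      rw [hlogz]; exact pow_le_pow_left₀ hτL0.le (by nlinarith) 8
    have hsqrtX : Real.sqrt X = X ^ (1 / 2 : ℝ) := Real.sqrt_eq_rpow X
    -- `2σ₀e^{35}C_W L^9 ≤ τ² √X e^{-L^{1/3}} ≤ τ²√X η`
    have hkey : 2 * σ₀ * Real.exp 35 * C_W * L ^ 9 ≤ τ ^ 2 * Real.sqrt X * η :=
      hE7.trans (mul_le_mul_of_nonneg_left hηlo (by positivity))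
    have hX52 : X ^ (5 / 2 : ℝ) = X ^ 2 * Real.sqrt X := by
      rw [hsqrtX, show (X ^ 2 : ℝ) = X ^ (2 : ℝ) by norm_cast, ← Real.rpow_add hX0]; norm_num
    calc σ₀ * η * Real.exp 3 / (3 * X * τ) * (C_W * (Real.exp 32 * Real.log z ^ 8) *
          ((6 * X ^ 3) ^ (2 / 3 : ℝ) * X ^ ((1 + τ) / 3) * D ^ (1 / 3 : ℝ) + D * X ^ (1 + τ)))
        ≤ σ₀ * η * Real.exp 3 / (3 * X * τ) * (C_W * (Real.exp 32 * L ^ 8) * (5 * X ^ (5 / 2 : ℝ))) := by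
          gcongr
      _ = (2 * σ₀ * Real.exp 35 * C_W * L ^ 9) * (5 / 6 * η * (X * Real.sqrt X) / (τ * L)) := by
          rw [hX52, show Real.exp 35 = Real.exp 3 * Real.exp 32 by rw [← Real.exp_add]; norm_num]
          have hXne : X ≠ 0 := hX0.ne'
          have hτne : τ ≠ 0 := hτ0.ne'
          have hLne : L ≠ 0 := hL0.ne'
          field_simp
          ring
      _ ≤ (τ ^ 2 * Real.sqrt X * η) * (5 / 6 * η * (X * Real.sqrt X) / (τ * L)) :=
          mul_le_mul_of_nonneg_right hkey (by positivity)
      _ = 5 / 6 * U := by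
          rw [hU, show (X ^ 2 : ℝ) = X * Real.sqrt X ^ 2 by rw [Real.sq_sqrt hX0.le]; ring]
          have hτne : τ ≠ 0 := hτ0.ne'
          have hLne : L ≠ 0 := hL0.ne'
          field_simp
      _ ≤ U := by linarith
  have hG3 : kappa σ₀ X η * (errB C_FL C_W C_B X η τ D * Real.exp W) ≤ (1 + σ₀ * Real.exp 3 * C_FL * gamma₀ * K_V + 1) * U := by
    have herrB0 : 0 ≤ errB C_FL C_W C_B X η τ D := by
      rw [errB]
      have hD0 : 0 < D := by linarith
      have : 0 ≤ Real.log (X ^ τ) := Real.log_nonneg (by linarith)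
      have := gamma₀_pos
      positivity
    calc kappa σ₀ X η * (errB C_FL C_W C_B X η τ D * Real.exp W)
        = (kappa σ₀ X η * Real.exp W) * errB C_FL C_W C_B X η τ D := by ring
      _ ≤ σ₀ * η * Real.exp 3 / (3 * X * τ) * errB C_FL C_W C_B X η τ D := mul_le_mul_of_nonneg_right hκ herrB0
      _ ≤ U + σ₀ * Real.exp 3 * C_FL * gamma₀ * K_V * U + U := by
          rw [errB, hs, mul_add, mul_add]
          exact add_le_add (add_le_add hG3a hG3b) hG3c
      _ = _ := by ring
  -- Group 4: the main terms
  have hG4a : η ^ 2 * X ^ 2 * Real.exp W * (C₇ * mertensProd z / Real.log z + σ₀ * (C₉ * mertensProd z / Real.log z)) ≤ U := by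
    rw [hlogz]
    have h1 : C₇ * mertensProd z / (τ * L) + σ₀ * (C₉ * mertensProd z / (τ * L)) ≤ (C₇ + σ₀ * C₉) * (14 / (τ * L)) / (τ * L) := by
      rw [show C₇ * mertensProd z / (τ * L) + σ₀ * (C₉ * mertensProd z / (τ * L)) = (C₇ + σ₀ * C₉) * mertensProd z / (τ * L) by ring]
      rw [mul_div_assoc, mul_div_assoc]
      exact mul_le_mul_of_nonneg_left (div_le_div_of_nonneg_right hV hτL0.le) (by positivity)
    calc η ^ 2 * X ^ 2 * Real.exp W * (C₇ * mertensProd z / (τ * L) + σ₀ * (C₉ * mertensProd z / (τ * L)))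
        ≤ η ^ 2 * X ^ 2 * (Real.exp 3 / τ) * ((C₇ + σ₀ * C₉) * (14 / (τ * L)) / (τ * L)) := by gcongr
      _ = (14 * Real.exp 3 * (C₇ + σ₀ * C₉)) / (τ ^ 4 * L) * U := by rw [hU]; field_simp
      _ ≤ 1 * U := by
          refine mul_le_mul_of_nonneg_right ?_ hU0.le
          rw [div_le_one (by positivity)]; exact hE4
      _ = U := one_mul U
  have hG4b : η ^ 2 * X ^ 2 * Real.exp W * (σ₀ * mertensProd z *
      (W * z⁻¹ + 12 / (z / 2) ^ (1 / 3 : ℝ) + 54 / (z / 2))) ≤ U := by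
    -- `W z⁻¹ + 12 (z/2)^{-1/3} + 54 (z/2)⁻¹ ≤ (1/τ + 135) z^{-1/3} ≤ 136 τ⁻¹ z^{-1/3}`
    have hz13 : 0 < z ^ (1 / 3 : ℝ) := Real.rpow_pos_of_pos hz0 _
    have hz1 : 1 ≤ z := by linarith
    have hzz : z ^ (1 / 3 : ℝ) ≤ z := by
      calc z ^ (1 / 3 : ℝ) ≤ z ^ (1 : ℝ) := Real.rpow_le_rpow_of_exponent_le hz1 (by norm_num)
        _ = z := Real.rpow_one z
    have hinvz : z⁻¹ ≤ (z ^ (1 / 3 : ℝ))⁻¹ := inv_anti₀ hz13 hzz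
    have hhalf : 12 / (z / 2) ^ (1 / 3 : ℝ) ≤ 24 * (z ^ (1 / 3 : ℝ))⁻¹ := by
      rw [Real.div_rpow hz0.le (by norm_num), div_div_eq_mul_div]
      have h2 : (2 : ℝ) ^ (1 / 3 : ℝ) ≤ 2 := by
        calc (2 : ℝ) ^ (1 / 3 : ℝ) ≤ (2 : ℝ) ^ (1 : ℝ) := Real.rpow_le_rpow_of_exponent_le (by norm_num) (by norm_num)
          _ = 2 := Real.rpow_one 2
      rw [div_eq_mul_inv]
      exact mul_le_mul_of_nonneg_right (by linarith [h2]) (inv_pos.mpr hz13).le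
    have hW0 : 0 ≤ W := smallPrimesWeight_nonneg X τ
    have hbr : W * z⁻¹ + 12 / (z / 2) ^ (1 / 3 : ℝ) + 54 / (z / 2) ≤ 136 * τ⁻¹ * (z ^ (1 / 3 : ℝ))⁻¹ := by
      have h54 : 54 / (z / 2) = 108 * z⁻¹ := by field_simp; ring
      rw [h54]
      have hτinv : 1 ≤ τ⁻¹ := one_le_inv₀ hτ0 |>.mpr hτ1
      have hWz : W * z⁻¹ ≤ (τ⁻¹ + 3) * (z ^ (1 / 3 : ℝ))⁻¹ := by
        calc W * z⁻¹ ≤ (1 / τ + 3) * z⁻¹ := mul_le_mul_of_nonneg_right hWle' (by positivity)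
          _ ≤ (τ⁻¹ + 3) * (z ^ (1 / 3 : ℝ))⁻¹ := by
              rw [one_div]; exact mul_le_mul_of_nonneg_left hinvz (by positivity)
      have h108 : 108 * z⁻¹ ≤ 108 * (z ^ (1 / 3 : ℝ))⁻¹ := mul_le_mul_of_nonneg_left hinvz (by norm_num)
      have hw0 : 0 ≤ (z ^ (1 / 3 : ℝ))⁻¹ := (inv_pos.mpr hz13).le
      have hw : (z ^ (1 / 3 : ℝ))⁻¹ ≤ τ⁻¹ * (z ^ (1 / 3 : ℝ))⁻¹ := le_mul_of_one_le_left hw0 hτinv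
      have hWz' : W * z⁻¹ ≤ τ⁻¹ * (z ^ (1 / 3 : ℝ))⁻¹ + 3 * (z ^ (1 / 3 : ℝ))⁻¹ := by linarith [hWz]
      linarith [hWz', hhalf, h108, hw]
    have hτz : 1904 * σ₀ * Real.exp 3 ≤ τ ^ 4 * z ^ (1 / 3 : ℝ) := hE5
    have hbr0 : 0 ≤ W * z⁻¹ + 12 / (z / 2) ^ (1 / 3 : ℝ) + 54 / (z / 2) := by positivity
    calc η ^ 2 * X ^ 2 * Real.exp W * (σ₀ * mertensProd z * (W * z⁻¹ + 12 / (z / 2) ^ (1 / 3 : ℝ) + 54 / (z / 2)))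
        ≤ η ^ 2 * X ^ 2 * (Real.exp 3 / τ) * (σ₀ * (14 / (τ * L)) * (136 * τ⁻¹ * (z ^ (1 / 3 : ℝ))⁻¹)) := by
          gcongr
      _ = (1904 * σ₀ * Real.exp 3) / (τ ^ 4 * z ^ (1 / 3 : ℝ)) * U := by rw [hU]; field_simp; ring
      _ ≤ 1 * U := by
          refine mul_le_mul_of_nonneg_right ?_ hU0.le
          rw [div_le_one (by positivity)]; exact hτz
      _ = U := one_mul U
  -- the class factor `ω = w(d)/d²`
  set ω := classWeight d / (d : ℝ) ^ 2 with hω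
  have hω0 : 0 ≤ ω := by rw [hω]; exact div_nonneg (classWeight_pos d).le (by positivity)
  have hωeq : classSizeA X η d * (prodA z * ∏ p ∈ d.primeFactors, (1 - densA p)⁻¹) =
      ω * (sizeA X η * prodA z) := by
    rw [hω, ← classProd_eq hd hdz, classSizeA_mul_classProd hd hdz]
  have hG1' : C_A * classSizeA X η d * (prodA z * ∏ p ∈ d.primeFactors, (1 - densA p)⁻¹) *
      Real.exp (-(1 / (4 * τ))) * Real.exp W ≤ ω * (C_A * C_PA * Real.exp 3 * U) := by
    calc C_A * classSizeA X η d * (prodA z * ∏ p ∈ d.primeFactors, (1 - densA p)⁻¹) *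
          Real.exp (-(1 / (4 * τ))) * Real.exp W
        = ω * (C_A * sizeA X η * prodA z * Real.exp (-(1 / (4 * τ))) * Real.exp W) := by
          rw [show C_A * classSizeA X η d * (prodA z * ∏ p ∈ d.primeFactors, (1 - densA p)⁻¹) =
            C_A * (classSizeA X η d * (prodA z * ∏ p ∈ d.primeFactors, (1 - densA p)⁻¹)) by ring,
            hωeq]
          ring
      _ ≤ ω * (C_A * C_PA * Real.exp 3 * U) := mul_le_mul_of_nonneg_left hG1 hω0
  have hG3' := mul_le_mul_of_nonneg_left hG3 hω0
  have hG4' : ω * (η ^ 2 * X ^ 2 * Real.exp W *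
      (C₇ * mertensProd z / Real.log z + σ₀ * (C₉ * mertensProd z / Real.log z) +
        σ₀ * mertensProd z * (W * z⁻¹ + 12 / (z / 2) ^ (1 / 3 : ℝ) + 54 / (z / 2)))) ≤
      ω * (U + U) := by
    refine mul_le_mul_of_nonneg_left ?_ hω0
    rw [mul_add]
    exact add_le_add hG4a hG4b
  -- total
  have htotal : ω * (C_A * C_PA * Real.exp 3 * U) + U +
      ω * ((1 + σ₀ * Real.exp 3 * C_FL * gamma₀ * K_V + 1) * U) + ω * (U + U) =
      (ω * (C_A * C_PA * Real.exp 3 + σ₀ * Real.exp 3 * C_FL * gamma₀ * K_V + 4) + 1) *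
        τ * η ^ 2 * X ^ 2 / L := by
    rw [hU]; ring
  rw [← htotal]
  exact hmaster.trans (add_le_add (add_le_add (add_le_add hG1' hG2) hG3') hG4')

end Literature.NumberTheory.Sieve.CubicSieve

end
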